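import Summits.KontsevichZagierPeriods.Zeta5Search.LaiSweepShard

/-!
# `κ₃` sweep certificate — shard file 091 of 127 (shards 637–643 of 889)

HONEST FRAMING. Systematic search; no irrationality claim unless certified. This file only checks,
by `decide +kernel`, shards 637–643 of the order-cell sweep of the `κ₃` point `(74, 2180, 444; δ74)`
(engine `LaiSweepEngine`, soundness `LaiSweepJump/Free/Eval/Shard/Kappa3`; a shard is `⟨regime, n,
p, q, p', q', Lo, Up⟩`: `n` cells from `p/q` to `p'/q'` with integer rate sums in `[Lo, Up]`, `K =
128`, `D = 2^40`). It draws NO conclusion: only the capstone `LaiKappa3SweepCert`, which needs all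
127 shard files, does. Kernel cost of this file ≈ 560 cells × 0.3 s.
-/

namespace Summit.KontsevichZagierPeriods.Zeta5Search.Sweep

set_option maxHeartbeats 100000000 in
/-- Shard 637: 80 cells of regime B from `300/439` to `254/371`.
[cite: Lai2024BallRivoal, §4 Lemma 4.3] -/
theorem shard637 :
    Shard.check 128 (2^40)
      ⟨true, 80, 300, 439, 254, 371, 12288522877906, 17337465486966⟩ = true := by
  decide +kernel

set_option maxHeartbeats 100000000 in
/-- Shard 638: 80 cells of regime B from `254/371` to `3295/4804`.
[cite: Lai2024BallRivoal, §4 Lemma 4.3] -/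
theorem shard638 :
    Shard.check 128 (2^40)
      ⟨true, 80, 254, 371, 3295, 4804, 12136156960496, 17140252021414⟩ = true := by
  decide +kernel

set_option maxHeartbeats 100000000 in
/-- Shard 639: 80 cells of regime B from `3295/4804` to `235/342`.
[cite: Lai2024BallRivoal, §4 Lemma 4.3] -/
theorem shard639 :
    Shard.check 128 (2^40)
      ⟨true, 80, 3295, 4804, 235, 342, 12095614595667, 17100721541205⟩ = true := by
  decide +kernel

set_option maxHeartbeats 100000000 in
/-- Shard 640: 80 cells of regime B from `235/342` to `243/353`.
[cite: Lai2024BallRivoal, §4 Lemma 4.3] -/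
theorem shard640 :
    Shard.check 128 (2^40)
      ⟨true, 80, 235, 342, 243, 353, 12107329821608, 17135307734298⟩ = true := by
  decide +kernel

set_option maxHeartbeats 100000000 in
/-- Shard 641: 80 cells of regime B from `243/353` to `20/29`.
[cite: Lai2024BallRivoal, §4 Lemma 4.3] -/
theorem shard641 :
    Shard.check 128 (2^40)
      ⟨true, 80, 243, 353, 20, 29, 12282571490683, 17401373710660⟩ = true := by
  decide +kernel

set_option maxHeartbeats 100000000 in
/-- Shard 642: 80 cells of regime B from `20/29` to `3319/4804`.
[cite: Lai2024BallRivoal, §4 Lemma 4.3] -/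
theorem shard642 :
    Shard.check 128 (2^40)
      ⟨true, 80, 20, 29, 3319, 4804, 11857860021571, 16817139479395⟩ = true := by
  decide +kernel

set_option maxHeartbeats 100000000 in
/-- Shard 643: 80 cells of regime B from `3319/4804` to `227/328`.
[cite: Lai2024BallRivoal, §4 Lemma 4.3] -/
theorem shard643 :
    Shard.check 128 (2^40)
      ⟨true, 80, 3319, 4804, 227, 328, 11485813922400, 16305838047650⟩ = true := by
  decide +kernel

/-- The checked shards of this file, in order. [folklore] -/
def shards091 : List (CheckedShard 128 (2^40)) :=
  [⟨_, shard637⟩, ⟨_, shard638⟩, ⟨_, shard639⟩, ⟨_, shard640⟩, ⟨_, shard641⟩,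
    ⟨_, shard642⟩, ⟨_, shard643⟩]

end Summit.KontsevichZagierPeriods.Zeta5Search.Sweep
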